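import Summits.Ventures.CertifiedManyBodySolver.Certificates.HubbardSquare_n7o8_tpbox_p4o25_p1o5_thermal_axis_C2markov3x3_j273931
import Summits.Ventures.CertifiedManyBodySolver.Certificates.HubbardSquare_n9o8_tpm1o4_thermal_axis_PH_C2markov3x3_j273931
import Literature.MathematicalPhysics.QuantumLattice.TorusLimitParticleHoleWordPullback
import Literature.MathematicalPhysics.QuantumLattice.HubbardTTPrimeBoxTransport
import HarnessLib

/-!
# Ventures/CertifiedManyBodySolver — ELECTRON-DOPED `t'`-FACE cells, second interval: `t' ∈ [−1/5, −4/25]` at `(U, n) = (8, 9/8)` (⊇ the top of the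
# NCCO object-M box `t'/t ∈ [−0.269, −0.168]` not covered by `[−0.3, −0.2]`), `β ∈ {1/2, …, 3}` and colder, by PARTICLE–HOLE from the image-side cells

HONEST FRAMING: first certified bounds; not a superconductivity verdict; every number certified or labelled float.
WHAT THIS IS NOT: not a phase sentence; not of record until the mbsolver LEAD pen + referee sign; energy WINDOWS for the tree's THERMAL object of the
ELECTRON-DOPED `t–t'` model (torus limits of the canonical sector Gibbs states of `hubbardTorusTT' L 1 s 8`, `s ∈ [−1/5, −4/25]`, on `N↑ = N↓ = ⌊9L²/16⌋`)
along `Ls → ∞` with `4 ∣ Ls j` eventually (flag «PH-transported, even-tori subsequence», cell ruling R-co); UPPER edges CONDITIONAL on the nodes of the image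
file `HubbardSquare_n7o8_tpbox_p4o25_p1o5_thermal_axis_C2markov3x3_j273931`, LOWER edges kernel; no new certificate; 0 core-h. Companion of
`HubbardSquare_n9o8_tpbox_m3o10_m1o5_thermal_axis_PH_C2markov3x3_j273931` (`s ∈ [−3/10, −1/5]`); same mechanism (instance-form pull-back
`IsTorusLimitOfMixture.meanEnergy_le_of_forall_image_cap`, shift `+1`; lower edge: Fermi sea at the `+1/4` anchor − `1.6212·(9/100)` + `U/8`).
HENCE for every `s ∈ [−1/5, −4/25]`, every torus limit at `β' ≥ β` along `4 ∣ L`: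
`β = 1/2`: `e ∈ [-0.8493958090, 1.5920518741]` · `β = 3/4`: `e ∈ [-0.8493958090, 1.3190052921]` · `β = 1`: `e ∈ [-0.8493958090, 1.1637574043]` · `β = 5/4`: `e ∈ [-0.8493958090, 1.0578186318]` · `β = 3/2`: `e ∈ [-0.8493958090, 0.9875737550]` · `β = 2`: `e ∈ [-0.8493958090, 0.8974019976]` · `β = 3`: `e ∈ [-0.8493958090, 0.8007786510]`.
Strength (upper edges) = the named nodes ∧ kernel theorems; retracted with any of them.
[cite: LiebWuPhysicaA2003, §1 eq. (3)] [cite: Israel1979, Lemma II.3.1] [cite: Israel1979, Thm. I.3.4] [cite: Lieb1973, §V (5.2)–(5.4)] [cite: PoulinHastings2011, eqs. (3)–(8)]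
[cite: Ruelle1969, §3.4] [cite: LiebLoss1993, §8, Theorem 8.2]
Seat prover-hubbard-downfold-unc-2-g8, 2026-08-27; zero solves, zero kit.
-/

noncomputable section

namespace Summit.Ventures.CertifiedManyBodySolver.Certificates

open Literature.MathematicalPhysics.QuantumLattice
open Literature.MathematicalPhysics.QuantumLattice.ThermodynamicLimit
open Literature.MathematicalPhysics.QuantumLattice.InfVolFermionState
open Literature.MathematicalPhysics.QuantumLattice.AndersonCluster
open Literature.Probability.LatticeModels
open _root_.Filter
open scoped ComplexOrder

/-- **Electron-doped ground-state floor on `s ∈ [−1/5, −4/25]`**, every `U ≥ 0`: `e(1, s, U, 9/8) ≥ −1.8493958090 + U/8` (Fermi sea at the image anchor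
`(1/4, 7/8)`, `t'`-Lipschitz `1.6212·|−s − 1/4| ≤ 1.6212·9/100`, particle–hole `+U/8`; kernel, no node). [cite: LiebLoss1993, §8, Theorem 8.2] [cite: Israel1979, Thm. I.3.4] -/
theorem ground_n9o8_tpbox2_floor_PH {U : ℝ} (hU : 0 ≤ U) {s : ℝ} (hs : s ∈ Set.Icc (-1 / 5 : ℝ) (-4 / 25)) :
    (-1.8493958090 : ℝ) + U * (1 / 8) ≤ energyDensityTT' 1 s U (9 / 8) := by
  have hanchor := ground_n7o8_tp1o4_floor_fermiSea hU
  have hlip := abs_energyDensityTT'_sub_tPrime_le_decimal 1 hU (n := 7 / 8) (by norm_num) (by norm_num) (-s) (1 / 4)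
  have habs : |(-s) - 1 / 4| ≤ 9 / 100 := abs_le.2 ⟨by linarith [hs.1, hs.2], by linarith [hs.1, hs.2]⟩
  have himg : (-1.8493958090 : ℝ) ≤ energyDensityTT' 1 (-s) U (2 - 9 / 8) := by
    rw [show (2 - 9 / 8 : ℝ) = 7 / 8 by norm_num]
    have h1 := (abs_le.1 (hlip.trans (mul_le_mul_of_nonneg_left habs (by norm_num)))).1
    linarith
  have h := energyDensityTT'_ge_of_particleHole_image 1 s hU (n := 9 / 8) (by norm_num) (by norm_num) himg
  linarith

/-- **LOWER EDGE on `s ∈ [−1/5, −4/25]`** (every `β`, every `Ls`, every `U ≥ 0`; no node): `−1.8493958090 + U/8 ≤ e(ω)`.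
[cite: Ruelle1969, §3.4] [cite: LiebWuPhysicaA2003, §1 eq. (3)] -/
theorem thermal_n9o8_tpbox2_lower {β U : ℝ} (hU : 0 ≤ U) {s : ℝ} (hs : s ∈ Set.Icc (-1 / 5 : ℝ) (-4 / 25)) {ω : InfVolFermionState 2}
    {Ls : ℕ → ℕ} (hLs : Tendsto Ls atTop atTop)
    (h : ω.IsTorusLimitOfMixture (sectorGibbsCount (9 / 8)) (fun L => sectorGibbsWeightTT' β 1 s U (9 / 8) L)
      (fun L => sectorGibbsVectorTT' 1 s U (9 / 8) L) Ls) :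
    (-1.8493958090 : ℝ) + U * (1 / 8) ≤ ω.meanEnergy (hubbardTTPrimeFermionInteraction 1 s U) 1 :=
  (ground_n9o8_tpbox2_floor_PH hU hs).trans
    (h.energyDensityTT'_le_meanEnergy_of_sectorGibbs 1 s U (n := 9 / 8) (by norm_num) (by norm_num) β hLs s hU)

/-- **ELECTRON-DOPED cap on `s ∈ [−1/5, −4/25]`, `β' ≥ 1/2`** (T = 2t and colder): `e_{Φ(1,s,8)}(ω) ≤ 1.5920518741` along `4 ∣ L`
(image cap `0.5920518741` + 1). Strength = C2(cert_c2sector_tp1o4_3x3_b1o2_j273931) ∧ C1(cert_feC1_3x2_b1o8_j263703) ∧ kernel theorems. [cite: LiebWuPhysicaA2003, §1 eq. (3)] [cite: Israel1979, Lemma II.3.1] -/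
theorem thermal_n9o8_tpbox2_upper_b1o2_PH_of_le (hC2 : cert_c2sector_tp1o4_3x3_b1o2_j273931) (hC1 : cert_feC1_3x2_b1o8_j263703) {s : ℝ}
    (hs : s ∈ Set.Icc (-1 / 5 : ℝ) (-4 / 25)) {β : ℝ} (hle : (1 / 2 : ℝ) ≤ β) {ω : InfVolFermionState 2} {Ls : ℕ → ℕ}
    (hLs : Tendsto Ls atTop atTop) (h4 : ∀ᶠ j in atTop, 4 ∣ Ls j)
    (h : ω.IsTorusLimitOfMixture (sectorGibbsCount (9 / 8)) (fun L => sectorGibbsWeightTT' β 1 s 8 (9 / 8) L)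
      (fun L => sectorGibbsVectorTT' 1 s 8 (9 / 8) L) Ls) :
    ω.meanEnergy (hubbardTTPrimeFermionInteraction 1 s 8) 1 ≤ (1.5920518741 : ℝ) := by
  have heven : ∀ᶠ j in atTop, Even (Ls j) :=
    h4.mono fun j hj => even_iff_two_dvd.2 (dvd_trans (by norm_num) hj)
  have hadd : ∀ᶠ j in atTop, halfRectN (7 / 8) (Ls j) + halfRectN (9 / 8) (Ls j) = Ls j ^ 2 :=
    h4.mono fun j hj => by
      have h' := halfRectN_compl_nine_eighths hj
      rwa [show (2 - 9 / 8 : ℝ) = 7 / 8 by norm_num] at h'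
  have hs' : -s ∈ Set.Icc (4 / 25 : ℝ) (1 / 5) := ⟨by linarith [hs.2], by linarith [hs.1]⟩
  have hmain := h.meanEnergy_le_of_forall_image_cap β 1 s 8 (s' := -s) (n' := 7 / 8) rfl (by norm_num) (by norm_num) (by norm_num)
    (fun Ls' ω' hLs' hω' => image_tpbox_p4o25_p1o5_upper_b1o2_of_le hC2 hC1 hs' hle hLs' hω') hLs heven hadd
  linarith

/-- **ELECTRON-DOPED WINDOW on `s ∈ [−1/5, −4/25]`, `β' ≥ 1/2`**: `e ∈ [-0.8493958090, 1.5920518741]`. [cite: LiebWuPhysicaA2003, §1 eq. (3)] [cite: Ruelle1969, §3.4] -/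
theorem thermal_n9o8_tpbox2_window_b1o2_PH_of_le (hC2 : cert_c2sector_tp1o4_3x3_b1o2_j273931) (hC1 : cert_feC1_3x2_b1o8_j263703) {s : ℝ}
    (hs : s ∈ Set.Icc (-1 / 5 : ℝ) (-4 / 25)) {β : ℝ} (hle : (1 / 2 : ℝ) ≤ β) {ω : InfVolFermionState 2} {Ls : ℕ → ℕ}
    (hLs : Tendsto Ls atTop atTop) (h4 : ∀ᶠ j in atTop, 4 ∣ Ls j)
    (h : ω.IsTorusLimitOfMixture (sectorGibbsCount (9 / 8)) (fun L => sectorGibbsWeightTT' β 1 s 8 (9 / 8) L)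
      (fun L => sectorGibbsVectorTT' 1 s 8 (9 / 8) L) Ls) :
    ω.meanEnergy (hubbardTTPrimeFermionInteraction 1 s 8) 1 ∈ Set.Icc (-0.8493958090 : ℝ) 1.5920518741 := by
  refine ⟨?_, thermal_n9o8_tpbox2_upper_b1o2_PH_of_le hC2 hC1 hs hle hLs h4 h⟩
  have hl := thermal_n9o8_tpbox2_lower (U := 8) (by norm_num) hs hLs h
  linarith

/-- **ELECTRON-DOPED cap on `s ∈ [−1/5, −4/25]`, `β' ≥ 3/4`** (T = 4t/3 and colder): `e_{Φ(1,s,8)}(ω) ≤ 1.3190052921` along `4 ∣ L`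
(image cap `0.3190052921` + 1). Strength = C2(cert_c2sector_tp1o4_3x3_b3o4_j273931) ∧ C1(cert_feC1_3x2_b1o8_j263703) ∧ kernel theorems. [cite: LiebWuPhysicaA2003, §1 eq. (3)] [cite: Israel1979, Lemma II.3.1] -/
theorem thermal_n9o8_tpbox2_upper_b3o4_PH_of_le (hC2 : cert_c2sector_tp1o4_3x3_b3o4_j273931) (hC1 : cert_feC1_3x2_b1o8_j263703) {s : ℝ}
    (hs : s ∈ Set.Icc (-1 / 5 : ℝ) (-4 / 25)) {β : ℝ} (hle : (3 / 4 : ℝ) ≤ β) {ω : InfVolFermionState 2} {Ls : ℕ → ℕ}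
    (hLs : Tendsto Ls atTop atTop) (h4 : ∀ᶠ j in atTop, 4 ∣ Ls j)
    (h : ω.IsTorusLimitOfMixture (sectorGibbsCount (9 / 8)) (fun L => sectorGibbsWeightTT' β 1 s 8 (9 / 8) L)
      (fun L => sectorGibbsVectorTT' 1 s 8 (9 / 8) L) Ls) :
    ω.meanEnergy (hubbardTTPrimeFermionInteraction 1 s 8) 1 ≤ (1.3190052921 : ℝ) := by
  have heven : ∀ᶠ j in atTop, Even (Ls j) :=
    h4.mono fun j hj => even_iff_two_dvd.2 (dvd_trans (by norm_num) hj)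
  have hadd : ∀ᶠ j in atTop, halfRectN (7 / 8) (Ls j) + halfRectN (9 / 8) (Ls j) = Ls j ^ 2 :=
    h4.mono fun j hj => by
      have h' := halfRectN_compl_nine_eighths hj
      rwa [show (2 - 9 / 8 : ℝ) = 7 / 8 by norm_num] at h'
  have hs' : -s ∈ Set.Icc (4 / 25 : ℝ) (1 / 5) := ⟨by linarith [hs.2], by linarith [hs.1]⟩
  have hmain := h.meanEnergy_le_of_forall_image_cap β 1 s 8 (s' := -s) (n' := 7 / 8) rfl (by norm_num) (by norm_num) (by norm_num)
    (fun Ls' ω' hLs' hω' => image_tpbox_p4o25_p1o5_upper_b3o4_of_le hC2 hC1 hs' hle hLs' hω') hLs heven hadd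
  linarith

/-- **ELECTRON-DOPED WINDOW on `s ∈ [−1/5, −4/25]`, `β' ≥ 3/4`**: `e ∈ [-0.8493958090, 1.3190052921]`. [cite: LiebWuPhysicaA2003, §1 eq. (3)] [cite: Ruelle1969, §3.4] -/
theorem thermal_n9o8_tpbox2_window_b3o4_PH_of_le (hC2 : cert_c2sector_tp1o4_3x3_b3o4_j273931) (hC1 : cert_feC1_3x2_b1o8_j263703) {s : ℝ}
    (hs : s ∈ Set.Icc (-1 / 5 : ℝ) (-4 / 25)) {β : ℝ} (hle : (3 / 4 : ℝ) ≤ β) {ω : InfVolFermionState 2} {Ls : ℕ → ℕ}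
    (hLs : Tendsto Ls atTop atTop) (h4 : ∀ᶠ j in atTop, 4 ∣ Ls j)
    (h : ω.IsTorusLimitOfMixture (sectorGibbsCount (9 / 8)) (fun L => sectorGibbsWeightTT' β 1 s 8 (9 / 8) L)
      (fun L => sectorGibbsVectorTT' 1 s 8 (9 / 8) L) Ls) :
    ω.meanEnergy (hubbardTTPrimeFermionInteraction 1 s 8) 1 ∈ Set.Icc (-0.8493958090 : ℝ) 1.3190052921 := by
  refine ⟨?_, thermal_n9o8_tpbox2_upper_b3o4_PH_of_le hC2 hC1 hs hle hLs h4 h⟩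
  have hl := thermal_n9o8_tpbox2_lower (U := 8) (by norm_num) hs hLs h
  linarith

/-- **ELECTRON-DOPED cap on `s ∈ [−1/5, −4/25]`, `β' ≥ 1`** (T = t and colder): `e_{Φ(1,s,8)}(ω) ≤ 1.1637574043` along `4 ∣ L`
(image cap `0.1637574043` + 1). Strength = C2(cert_c2sector_tp1o4_3x3_b1_j273931) ∧ C1(cert_feC1_3x2_b1o4_j262363) ∧ kernel theorems. [cite: LiebWuPhysicaA2003, §1 eq. (3)] [cite: Israel1979, Lemma II.3.1] -/
theorem thermal_n9o8_tpbox2_upper_b1_PH_of_le (hC2 : cert_c2sector_tp1o4_3x3_b1_j273931) (hC1 : cert_feC1_3x2_b1o4_j262363) {s : ℝ}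
    (hs : s ∈ Set.Icc (-1 / 5 : ℝ) (-4 / 25)) {β : ℝ} (hle : (1 : ℝ) ≤ β) {ω : InfVolFermionState 2} {Ls : ℕ → ℕ}
    (hLs : Tendsto Ls atTop atTop) (h4 : ∀ᶠ j in atTop, 4 ∣ Ls j)
    (h : ω.IsTorusLimitOfMixture (sectorGibbsCount (9 / 8)) (fun L => sectorGibbsWeightTT' β 1 s 8 (9 / 8) L)
      (fun L => sectorGibbsVectorTT' 1 s 8 (9 / 8) L) Ls) :
    ω.meanEnergy (hubbardTTPrimeFermionInteraction 1 s 8) 1 ≤ (1.1637574043 : ℝ) := by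
  have heven : ∀ᶠ j in atTop, Even (Ls j) :=
    h4.mono fun j hj => even_iff_two_dvd.2 (dvd_trans (by norm_num) hj)
  have hadd : ∀ᶠ j in atTop, halfRectN (7 / 8) (Ls j) + halfRectN (9 / 8) (Ls j) = Ls j ^ 2 :=
    h4.mono fun j hj => by
      have h' := halfRectN_compl_nine_eighths hj
      rwa [show (2 - 9 / 8 : ℝ) = 7 / 8 by norm_num] at h'
  have hs' : -s ∈ Set.Icc (4 / 25 : ℝ) (1 / 5) := ⟨by linarith [hs.2], by linarith [hs.1]⟩
  have hmain := h.meanEnergy_le_of_forall_image_cap β 1 s 8 (s' := -s) (n' := 7 / 8) rfl (by norm_num) (by norm_num) (by norm_num)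
    (fun Ls' ω' hLs' hω' => image_tpbox_p4o25_p1o5_upper_b1_of_le hC2 hC1 hs' hle hLs' hω') hLs heven hadd
  linarith

/-- **ELECTRON-DOPED WINDOW on `s ∈ [−1/5, −4/25]`, `β' ≥ 1`**: `e ∈ [-0.8493958090, 1.1637574043]`. [cite: LiebWuPhysicaA2003, §1 eq. (3)] [cite: Ruelle1969, §3.4] -/
theorem thermal_n9o8_tpbox2_window_b1_PH_of_le (hC2 : cert_c2sector_tp1o4_3x3_b1_j273931) (hC1 : cert_feC1_3x2_b1o4_j262363) {s : ℝ}
    (hs : s ∈ Set.Icc (-1 / 5 : ℝ) (-4 / 25)) {β : ℝ} (hle : (1 : ℝ) ≤ β) {ω : InfVolFermionState 2} {Ls : ℕ → ℕ}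
    (hLs : Tendsto Ls atTop atTop) (h4 : ∀ᶠ j in atTop, 4 ∣ Ls j)
    (h : ω.IsTorusLimitOfMixture (sectorGibbsCount (9 / 8)) (fun L => sectorGibbsWeightTT' β 1 s 8 (9 / 8) L)
      (fun L => sectorGibbsVectorTT' 1 s 8 (9 / 8) L) Ls) :
    ω.meanEnergy (hubbardTTPrimeFermionInteraction 1 s 8) 1 ∈ Set.Icc (-0.8493958090 : ℝ) 1.1637574043 := by
  refine ⟨?_, thermal_n9o8_tpbox2_upper_b1_PH_of_le hC2 hC1 hs hle hLs h4 h⟩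
  have hl := thermal_n9o8_tpbox2_lower (U := 8) (by norm_num) hs hLs h
  linarith

/-- **ELECTRON-DOPED cap on `s ∈ [−1/5, −4/25]`, `β' ≥ 5/4`** (T = 4t/5 and colder): `e_{Φ(1,s,8)}(ω) ≤ 1.0578186318` along `4 ∣ L`
(image cap `0.0578186318` + 1). Strength = C2(cert_c2sector_tp1o4_3x3_b5o4_j273931) ∧ C1(cert_feC1_3x2_b1o4_j262363) ∧ kernel theorems. [cite: LiebWuPhysicaA2003, §1 eq. (3)] [cite: Israel1979, Lemma II.3.1] -/
theorem thermal_n9o8_tpbox2_upper_b5o4_PH_of_le (hC2 : cert_c2sector_tp1o4_3x3_b5o4_j273931) (hC1 : cert_feC1_3x2_b1o4_j262363) {s : ℝ}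
    (hs : s ∈ Set.Icc (-1 / 5 : ℝ) (-4 / 25)) {β : ℝ} (hle : (5 / 4 : ℝ) ≤ β) {ω : InfVolFermionState 2} {Ls : ℕ → ℕ}
    (hLs : Tendsto Ls atTop atTop) (h4 : ∀ᶠ j in atTop, 4 ∣ Ls j)
    (h : ω.IsTorusLimitOfMixture (sectorGibbsCount (9 / 8)) (fun L => sectorGibbsWeightTT' β 1 s 8 (9 / 8) L)
      (fun L => sectorGibbsVectorTT' 1 s 8 (9 / 8) L) Ls) :
    ω.meanEnergy (hubbardTTPrimeFermionInteraction 1 s 8) 1 ≤ (1.0578186318 : ℝ) := by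
  have heven : ∀ᶠ j in atTop, Even (Ls j) :=
    h4.mono fun j hj => even_iff_two_dvd.2 (dvd_trans (by norm_num) hj)
  have hadd : ∀ᶠ j in atTop, halfRectN (7 / 8) (Ls j) + halfRectN (9 / 8) (Ls j) = Ls j ^ 2 :=
    h4.mono fun j hj => by
      have h' := halfRectN_compl_nine_eighths hj
      rwa [show (2 - 9 / 8 : ℝ) = 7 / 8 by norm_num] at h'
  have hs' : -s ∈ Set.Icc (4 / 25 : ℝ) (1 / 5) := ⟨by linarith [hs.2], by linarith [hs.1]⟩
  have hmain := h.meanEnergy_le_of_forall_image_cap β 1 s 8 (s' := -s) (n' := 7 / 8) rfl (by norm_num) (by norm_num) (by norm_num)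
    (fun Ls' ω' hLs' hω' => image_tpbox_p4o25_p1o5_upper_b5o4_of_le hC2 hC1 hs' hle hLs' hω') hLs heven hadd
  linarith

/-- **ELECTRON-DOPED WINDOW on `s ∈ [−1/5, −4/25]`, `β' ≥ 5/4`**: `e ∈ [-0.8493958090, 1.0578186318]`. [cite: LiebWuPhysicaA2003, §1 eq. (3)] [cite: Ruelle1969, §3.4] -/
theorem thermal_n9o8_tpbox2_window_b5o4_PH_of_le (hC2 : cert_c2sector_tp1o4_3x3_b5o4_j273931) (hC1 : cert_feC1_3x2_b1o4_j262363) {s : ℝ}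
    (hs : s ∈ Set.Icc (-1 / 5 : ℝ) (-4 / 25)) {β : ℝ} (hle : (5 / 4 : ℝ) ≤ β) {ω : InfVolFermionState 2} {Ls : ℕ → ℕ}
    (hLs : Tendsto Ls atTop atTop) (h4 : ∀ᶠ j in atTop, 4 ∣ Ls j)
    (h : ω.IsTorusLimitOfMixture (sectorGibbsCount (9 / 8)) (fun L => sectorGibbsWeightTT' β 1 s 8 (9 / 8) L)
      (fun L => sectorGibbsVectorTT' 1 s 8 (9 / 8) L) Ls) :
    ω.meanEnergy (hubbardTTPrimeFermionInteraction 1 s 8) 1 ∈ Set.Icc (-0.8493958090 : ℝ) 1.0578186318 := by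
  refine ⟨?_, thermal_n9o8_tpbox2_upper_b5o4_PH_of_le hC2 hC1 hs hle hLs h4 h⟩
  have hl := thermal_n9o8_tpbox2_lower (U := 8) (by norm_num) hs hLs h
  linarith

/-- **ELECTRON-DOPED cap on `s ∈ [−1/5, −4/25]`, `β' ≥ 3/2`** (T = 2t/3 and colder): `e_{Φ(1,s,8)}(ω) ≤ 0.9875737550` along `4 ∣ L`
(image cap `-0.0124262450` + 1). Strength = C2(cert_c2sector_tp1o4_3x3_b3o2_j273931) ∧ C1(cert_feC1_3x2_b1o4_j262363) ∧ kernel theorems. [cite: LiebWuPhysicaA2003, §1 eq. (3)] [cite: Israel1979, Lemma II.3.1] -/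
theorem thermal_n9o8_tpbox2_upper_b3o2_PH_of_le (hC2 : cert_c2sector_tp1o4_3x3_b3o2_j273931) (hC1 : cert_feC1_3x2_b1o4_j262363) {s : ℝ}
    (hs : s ∈ Set.Icc (-1 / 5 : ℝ) (-4 / 25)) {β : ℝ} (hle : (3 / 2 : ℝ) ≤ β) {ω : InfVolFermionState 2} {Ls : ℕ → ℕ}
    (hLs : Tendsto Ls atTop atTop) (h4 : ∀ᶠ j in atTop, 4 ∣ Ls j)
    (h : ω.IsTorusLimitOfMixture (sectorGibbsCount (9 / 8)) (fun L => sectorGibbsWeightTT' β 1 s 8 (9 / 8) L)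
      (fun L => sectorGibbsVectorTT' 1 s 8 (9 / 8) L) Ls) :
    ω.meanEnergy (hubbardTTPrimeFermionInteraction 1 s 8) 1 ≤ (0.9875737550 : ℝ) := by
  have heven : ∀ᶠ j in atTop, Even (Ls j) :=
    h4.mono fun j hj => even_iff_two_dvd.2 (dvd_trans (by norm_num) hj)
  have hadd : ∀ᶠ j in atTop, halfRectN (7 / 8) (Ls j) + halfRectN (9 / 8) (Ls j) = Ls j ^ 2 :=
    h4.mono fun j hj => by
      have h' := halfRectN_compl_nine_eighths hj
      rwa [show (2 - 9 / 8 : ℝ) = 7 / 8 by norm_num] at h'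
  have hs' : -s ∈ Set.Icc (4 / 25 : ℝ) (1 / 5) := ⟨by linarith [hs.2], by linarith [hs.1]⟩
  have hmain := h.meanEnergy_le_of_forall_image_cap β 1 s 8 (s' := -s) (n' := 7 / 8) rfl (by norm_num) (by norm_num) (by norm_num)
    (fun Ls' ω' hLs' hω' => image_tpbox_p4o25_p1o5_upper_b3o2_of_le hC2 hC1 hs' hle hLs' hω') hLs heven hadd
  linarith

/-- **ELECTRON-DOPED WINDOW on `s ∈ [−1/5, −4/25]`, `β' ≥ 3/2`**: `e ∈ [-0.8493958090, 0.9875737550]`. [cite: LiebWuPhysicaA2003, §1 eq. (3)] [cite: Ruelle1969, §3.4] -/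
theorem thermal_n9o8_tpbox2_window_b3o2_PH_of_le (hC2 : cert_c2sector_tp1o4_3x3_b3o2_j273931) (hC1 : cert_feC1_3x2_b1o4_j262363) {s : ℝ}
    (hs : s ∈ Set.Icc (-1 / 5 : ℝ) (-4 / 25)) {β : ℝ} (hle : (3 / 2 : ℝ) ≤ β) {ω : InfVolFermionState 2} {Ls : ℕ → ℕ}
    (hLs : Tendsto Ls atTop atTop) (h4 : ∀ᶠ j in atTop, 4 ∣ Ls j)
    (h : ω.IsTorusLimitOfMixture (sectorGibbsCount (9 / 8)) (fun L => sectorGibbsWeightTT' β 1 s 8 (9 / 8) L)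
      (fun L => sectorGibbsVectorTT' 1 s 8 (9 / 8) L) Ls) :
    ω.meanEnergy (hubbardTTPrimeFermionInteraction 1 s 8) 1 ∈ Set.Icc (-0.8493958090 : ℝ) 0.9875737550 := by
  refine ⟨?_, thermal_n9o8_tpbox2_upper_b3o2_PH_of_le hC2 hC1 hs hle hLs h4 h⟩
  have hl := thermal_n9o8_tpbox2_lower (U := 8) (by norm_num) hs hLs h
  linarith

/-- **ELECTRON-DOPED cap on `s ∈ [−1/5, −4/25]`, `β' ≥ 2`** (T = t/2 and colder): `e_{Φ(1,s,8)}(ω) ≤ 0.8974019976` along `4 ∣ L`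
(image cap `-0.1025980024` + 1). Strength = C2(cert_c2sector_tp1o4_3x3_b2_j273931) ∧ C1(cert_feC1_3x2_b1o4_j262363) ∧ kernel theorems. [cite: LiebWuPhysicaA2003, §1 eq. (3)] [cite: Israel1979, Lemma II.3.1] -/
theorem thermal_n9o8_tpbox2_upper_b2_PH_of_le (hC2 : cert_c2sector_tp1o4_3x3_b2_j273931) (hC1 : cert_feC1_3x2_b1o4_j262363) {s : ℝ}
    (hs : s ∈ Set.Icc (-1 / 5 : ℝ) (-4 / 25)) {β : ℝ} (hle : (2 : ℝ) ≤ β) {ω : InfVolFermionState 2} {Ls : ℕ → ℕ}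
    (hLs : Tendsto Ls atTop atTop) (h4 : ∀ᶠ j in atTop, 4 ∣ Ls j)
    (h : ω.IsTorusLimitOfMixture (sectorGibbsCount (9 / 8)) (fun L => sectorGibbsWeightTT' β 1 s 8 (9 / 8) L)
      (fun L => sectorGibbsVectorTT' 1 s 8 (9 / 8) L) Ls) :
    ω.meanEnergy (hubbardTTPrimeFermionInteraction 1 s 8) 1 ≤ (0.8974019976 : ℝ) := by
  have heven : ∀ᶠ j in atTop, Even (Ls j) :=
    h4.mono fun j hj => even_iff_two_dvd.2 (dvd_trans (by norm_num) hj)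
  have hadd : ∀ᶠ j in atTop, halfRectN (7 / 8) (Ls j) + halfRectN (9 / 8) (Ls j) = Ls j ^ 2 :=
    h4.mono fun j hj => by
      have h' := halfRectN_compl_nine_eighths hj
      rwa [show (2 - 9 / 8 : ℝ) = 7 / 8 by norm_num] at h'
  have hs' : -s ∈ Set.Icc (4 / 25 : ℝ) (1 / 5) := ⟨by linarith [hs.2], by linarith [hs.1]⟩
  have hmain := h.meanEnergy_le_of_forall_image_cap β 1 s 8 (s' := -s) (n' := 7 / 8) rfl (by norm_num) (by norm_num) (by norm_num)
    (fun Ls' ω' hLs' hω' => image_tpbox_p4o25_p1o5_upper_b2_of_le hC2 hC1 hs' hle hLs' hω') hLs heven hadd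
  linarith

/-- **ELECTRON-DOPED WINDOW on `s ∈ [−1/5, −4/25]`, `β' ≥ 2`**: `e ∈ [-0.8493958090, 0.8974019976]`. [cite: LiebWuPhysicaA2003, §1 eq. (3)] [cite: Ruelle1969, §3.4] -/
theorem thermal_n9o8_tpbox2_window_b2_PH_of_le (hC2 : cert_c2sector_tp1o4_3x3_b2_j273931) (hC1 : cert_feC1_3x2_b1o4_j262363) {s : ℝ}
    (hs : s ∈ Set.Icc (-1 / 5 : ℝ) (-4 / 25)) {β : ℝ} (hle : (2 : ℝ) ≤ β) {ω : InfVolFermionState 2} {Ls : ℕ → ℕ}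
    (hLs : Tendsto Ls atTop atTop) (h4 : ∀ᶠ j in atTop, 4 ∣ Ls j)
    (h : ω.IsTorusLimitOfMixture (sectorGibbsCount (9 / 8)) (fun L => sectorGibbsWeightTT' β 1 s 8 (9 / 8) L)
      (fun L => sectorGibbsVectorTT' 1 s 8 (9 / 8) L) Ls) :
    ω.meanEnergy (hubbardTTPrimeFermionInteraction 1 s 8) 1 ∈ Set.Icc (-0.8493958090 : ℝ) 0.8974019976 := by
  refine ⟨?_, thermal_n9o8_tpbox2_upper_b2_PH_of_le hC2 hC1 hs hle hLs h4 h⟩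
  have hl := thermal_n9o8_tpbox2_lower (U := 8) (by norm_num) hs hLs h
  linarith

/-- **ELECTRON-DOPED cap on `s ∈ [−1/5, −4/25]`, `β' ≥ 3`** (T = t/3 and colder): `e_{Φ(1,s,8)}(ω) ≤ 0.8007786510` along `4 ∣ L`
(image cap `-0.1992213490` + 1). Strength = C2(cert_c2sector_tp1o4_3x3_b3_j273931) ∧ C1(cert_feC1_3x2_b3o8_j263703) ∧ kernel theorems. [cite: LiebWuPhysicaA2003, §1 eq. (3)] [cite: Israel1979, Lemma II.3.1] -/
theorem thermal_n9o8_tpbox2_upper_b3_PH_of_le (hC2 : cert_c2sector_tp1o4_3x3_b3_j273931) (hC1 : cert_feC1_3x2_b3o8_j263703) {s : ℝ}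
    (hs : s ∈ Set.Icc (-1 / 5 : ℝ) (-4 / 25)) {β : ℝ} (hle : (3 : ℝ) ≤ β) {ω : InfVolFermionState 2} {Ls : ℕ → ℕ}
    (hLs : Tendsto Ls atTop atTop) (h4 : ∀ᶠ j in atTop, 4 ∣ Ls j)
    (h : ω.IsTorusLimitOfMixture (sectorGibbsCount (9 / 8)) (fun L => sectorGibbsWeightTT' β 1 s 8 (9 / 8) L)
      (fun L => sectorGibbsVectorTT' 1 s 8 (9 / 8) L) Ls) :
    ω.meanEnergy (hubbardTTPrimeFermionInteraction 1 s 8) 1 ≤ (0.8007786510 : ℝ) := by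
  have heven : ∀ᶠ j in atTop, Even (Ls j) :=
    h4.mono fun j hj => even_iff_two_dvd.2 (dvd_trans (by norm_num) hj)
  have hadd : ∀ᶠ j in atTop, halfRectN (7 / 8) (Ls j) + halfRectN (9 / 8) (Ls j) = Ls j ^ 2 :=
    h4.mono fun j hj => by
      have h' := halfRectN_compl_nine_eighths hj
      rwa [show (2 - 9 / 8 : ℝ) = 7 / 8 by norm_num] at h'
  have hs' : -s ∈ Set.Icc (4 / 25 : ℝ) (1 / 5) := ⟨by linarith [hs.2], by linarith [hs.1]⟩
  have hmain := h.meanEnergy_le_of_forall_image_cap β 1 s 8 (s' := -s) (n' := 7 / 8) rfl (by norm_num) (by norm_num) (by norm_num)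
    (fun Ls' ω' hLs' hω' => image_tpbox_p4o25_p1o5_upper_b3_of_le hC2 hC1 hs' hle hLs' hω') hLs heven hadd
  linarith

/-- **ELECTRON-DOPED WINDOW on `s ∈ [−1/5, −4/25]`, `β' ≥ 3`**: `e ∈ [-0.8493958090, 0.8007786510]`. [cite: LiebWuPhysicaA2003, §1 eq. (3)] [cite: Ruelle1969, §3.4] -/
theorem thermal_n9o8_tpbox2_window_b3_PH_of_le (hC2 : cert_c2sector_tp1o4_3x3_b3_j273931) (hC1 : cert_feC1_3x2_b3o8_j263703) {s : ℝ}
    (hs : s ∈ Set.Icc (-1 / 5 : ℝ) (-4 / 25)) {β : ℝ} (hle : (3 : ℝ) ≤ β) {ω : InfVolFermionState 2} {Ls : ℕ → ℕ}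
    (hLs : Tendsto Ls atTop atTop) (h4 : ∀ᶠ j in atTop, 4 ∣ Ls j)
    (h : ω.IsTorusLimitOfMixture (sectorGibbsCount (9 / 8)) (fun L => sectorGibbsWeightTT' β 1 s 8 (9 / 8) L)
      (fun L => sectorGibbsVectorTT' 1 s 8 (9 / 8) L) Ls) :
    ω.meanEnergy (hubbardTTPrimeFermionInteraction 1 s 8) 1 ∈ Set.Icc (-0.8493958090 : ℝ) 0.8007786510 := by
  refine ⟨?_, thermal_n9o8_tpbox2_upper_b3_PH_of_le hC2 hC1 hs hle hLs h4 h⟩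
  have hl := thermal_n9o8_tpbox2_lower (U := 8) (by norm_num) hs hLs h
  linarith

end Summit.Ventures.CertifiedManyBodySolver.Certificates

end
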